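import Literature.NumberTheory.Automorphic.LocalPiSchwartzBruhatFourier
import Literature.NumberTheory.Automorphic.LocalSchwartzBruhatDirectSum
import Literature.NumberTheory.Automorphic.RankOneFiniteAdeleWeil
import HarnessLib

/-!
# The partial Fourier transform in the sum variable is an automorphism of `𝒮(F^{κ ⊕ κ})`

Topic `NumberTheory/Automorphic`; namespace `Literature.NumberTheory.Automorphic`. KERNEL mathematics only (definitions
with bodies + theorems; no named fact, no `axiom`, no `sorry`).

Setting: `F` a non-archimedean local field with `2` invertible, `κ, ι` finite index types with `e : κ ⊕ κ ≃ ι` (the tree's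
coordinates `glue e a b`, `resL e`, `resR e` of `LocalSchwartzBruhatDirectSum`), `ψ` a continuous non-trivial character,
`μ` an additive Haar measure on `F^κ`, `T₀ : Matrix κ κ F` with `det T₀` a unit. For `Φ : F^ι → ℂ` the **partial
Fourier transform in the sum variable** is

  `(partialFourierSum ψ μ T₀ e Φ)(a ⊔ b) = ∫ ψ(u ⬝ᵥ T₀ b) Φ((u + a) ⊔ (u − a)) dμ(u)`

(the operator of the doubling / mixed-model change of polarisation, [MoeglinVignerasWaldspurger1987] Chap. 2 II.6–II.7;
[Kudla1994] §2). Main results: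

* `partialFourierSum_apply_glue` — the defining formula on glued vectors;
* `sumShearHomeomorph e` (`u ⊔ a ↦ (u + a) ⊔ (u − a)`) and `matrixMulVecHomeomorph T₀` (`b ↦ T₀ b`); precomposition
  with them is the tree's `compHomeomorphSB` (`RankOneFiniteAdeleWeil`);
* **`partialFourierSumEquivSB`** — the operator AS A LINEAR AUTOMORPHISM of `𝒮(F^ι)`: precomposition with the shear, then
  `𝒮(F^ι) = 𝒮(F^κ) ⊗ 𝒮(F^κ)` (`sumEquivSB`), swap of the factors, and on the (new) second factor the Fourier automorphism
  `piFourierEquivSB` followed by precomposition with `T₀`; the key identity **`coe_partialFourierSumEquivSB`** says that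
  its underlying function IS `partialFourierSum ψ μ T₀ e Φ` (on pure tensors `f₁ ⊠ f₂` read through the shear the
  integral is `f₂(a) · f̂₁(T₀ b)`, `sumFourierSlotEquivSB_boxSB_apply_glue`; additivity from the integrability of Schwartz–Bruhat slices);
* corollaries: `partialFourierSum_mem_schwartzBruhat` (stability), `partialFourierSum_injective` (partial Fourier
  inversion) and surjectivity (`partialFourierSum_surjective`).

## References
* [MoeglinVignerasWaldspurger1987] C. Mœglin, M.-F. Vignéras, J.-L. Waldspurger, LNM 1291 (1987), Chap. 2 II.6–II.7
  (change of polarisation by a partial Fourier transform).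
* [Kudla1994] S. Kudla, *Splitting metaplectic covers of dual reductive pairs*, Israel J. Math. 87 (1994), §2.
* [WeilBNT1967] A. Weil, *Basic Number Theory* (1967), Chap. VII §2, Prop. 2 (standard functions and Fourier transforms).
-/

set_option autoImplicit false

noncomputable section

open MeasureTheory
open scoped TensorProduct

namespace Literature.NumberTheory.Automorphic

open Literature.NumberTheory.GaloisRepresentations.IsNonarchimedeanLocalField
open Literature.RepresentationTheory.HeisenbergGroup

/-! ## §1 The shear and the matrix homeomorphisms (precomposition: the tree's `compHomeomorphSB`) -/


section Shear

variable {F : Type*} [Field F] [TopologicalSpace F] [IsTopologicalRing F] [Invertible (2 : F)]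
  {κ ι : Type*} (e : κ ⊕ κ ≃ ι)

/-- **the shear `u ⊔ a ↦ (u + a) ⊔ (u − a)`** of `F^ι = F^κ ⊕ F^κ` (inverse `x ⊔ y ↦ ½(x + y) ⊔ ½(x − y)`), as a
homeomorphism. [cite: MoeglinVignerasWaldspurger1987, Chap. 2 II.7] -/
def sumShearHomeomorph : (ι → F) ≃ₜ (ι → F) where
  toFun v := glue e (resL e v + resR e v) (resL e v - resR e v)
  invFun w := glue e ((⅟(2 : F)) • (resL e w + resR e w)) ((⅟(2 : F)) • (resL e w - resR e w))
  left_inv v := by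
    have h1 : resL e v + resR e v + (resL e v - resR e v) = (2 : F) • resL e v := by rw [two_smul]; abel
    have h2 : resL e v + resR e v - (resL e v - resR e v) = (2 : F) • resR e v := by rw [two_smul]; abel
    simp only [resL_glue, resR_glue, h1, h2, smul_smul, invOf_mul_self, one_smul, glue_resL_resR]
  right_inv w := by
    have h : ⅟(2 : F) • (resL e w + resR e w) + ⅟(2 : F) • (resL e w - resR e w) = resL e w := by
      rw [← smul_add, show resL e w + resR e w + (resL e w - resR e w) = (2 : F) • resL e w by rw [two_smul]; abel,
        smul_smul, invOf_mul_self, one_smul]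
    have h' : ⅟(2 : F) • (resL e w + resR e w) - ⅟(2 : F) • (resL e w - resR e w) = resR e w := by
      rw [← smul_sub, show resL e w + resR e w - (resL e w - resR e w) = (2 : F) • resR e w by rw [two_smul]; abel,
        smul_smul, invOf_mul_self, one_smul]
    simp only [resL_glue, resR_glue, h, h', glue_resL_resR]
  continuous_toFun := by
    show Continuous ((fun p : (κ → F) × (κ → F) => glue e p.1 p.2) ∘
      fun v => (resL e v + resR e v, resL e v - resR e v))
    exact (continuous_glue e).comp
      (((continuous_resL e).add (continuous_resR e)).prodMk ((continuous_resL e).sub (continuous_resR e)))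
  continuous_invFun := by
    show Continuous ((fun p : (κ → F) × (κ → F) => glue e p.1 p.2) ∘
      fun w => ((⅟(2 : F)) • (resL e w + resR e w), (⅟(2 : F)) • (resL e w - resR e w)))
    exact (continuous_glue e).comp
      ((((continuous_resL e).add (continuous_resR e)).const_smul (⅟(2 : F))).prodMk
        (((continuous_resL e).sub (continuous_resR e)).const_smul (⅟(2 : F))))

/-- formula on glued vectors: `shear (u ⊔ a) = (u + a) ⊔ (u − a)`. [cite: MoeglinVignerasWaldspurger1987, Chap. 2 II.7] -/
@[simp] theorem sumShearHomeomorph_glue (u a : κ → F) :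
    sumShearHomeomorph e (glue e u a) = glue e (u + a) (u - a) := by
  change glue e (resL e (glue e u a) + resR e (glue e u a)) (resL e (glue e u a) - resR e (glue e u a)) = _
  rw [resL_glue, resR_glue]

end Shear

section MulVec

variable {F : Type*} [Field F] [TopologicalSpace F] [IsTopologicalRing F] {κ : Type*} [Fintype κ] [DecidableEq κ]
  (T₀ : Matrix κ κ F) (hT₀ : IsUnit T₀.det)

/-- **`b ↦ T₀ b` as a homeomorphism of `F^κ`** (`det T₀` a unit; inverse `b ↦ T₀⁻¹ b`). [cite: Kudla1994, §2] -/
def matrixMulVecHomeomorph : (κ → F) ≃ₜ (κ → F) where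
  toFun b := T₀.mulVec b
  invFun b := T₀⁻¹.mulVec b
  left_inv b := by
    change T₀⁻¹.mulVec (T₀.mulVec b) = b
    rw [Matrix.mulVec_mulVec, Matrix.nonsing_inv_mul T₀ hT₀, Matrix.one_mulVec]
  right_inv b := by
    change T₀.mulVec (T₀⁻¹.mulVec b) = b
    rw [Matrix.mulVec_mulVec, Matrix.mul_nonsing_inv T₀ hT₀, Matrix.one_mulVec]
  continuous_toFun := LinearMap.continuous_on_pi (Matrix.mulVecLin T₀)
  continuous_invFun := LinearMap.continuous_on_pi (Matrix.mulVecLin T₀⁻¹)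

/-- formula. [cite: Kudla1994, §2] -/
@[simp] theorem matrixMulVecHomeomorph_apply (b : κ → F) : matrixMulVecHomeomorph T₀ hT₀ b = T₀.mulVec b := rfl

end MulVec

/-! ## §2 The partial Fourier transform in the sum variable -/

section Def

variable {F : Type*} [Field F] {κ ι : Type*} [Fintype κ] [MeasurableSpace (κ → F)] (ψ : AddChar F Circle)
  (μ : Measure (κ → F)) (T₀ : Matrix κ κ F) (e : κ ⊕ κ ≃ ι)

/-- **the partial Fourier transform in the sum variable**: for `Φ : F^ι → ℂ`,
`(partialFourierSum Φ)(v) = ∫ ψ(u ⬝ᵥ T₀ (v|₂)) Φ((u + v|₁) ⊔ (u − v|₁)) dμ(u)`, i.e. on glued vectors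
`(a ⊔ b) ↦ ∫ ψ(u ⬝ᵥ T₀ b) Φ((u + a) ⊔ (u − a)) dμ(u)`. [cite: MoeglinVignerasWaldspurger1987, Chap. 2 II.7] -/
def partialFourierSum (Φ : (ι → F) → ℂ) : (ι → F) → ℂ := fun v =>
  ∫ u, ((ψ (u ⬝ᵥ (T₀.mulVec (resR e v))) : Circle) : ℂ) * Φ (glue e (u + resL e v) (u - resL e v)) ∂μ

/-- **the defining formula on glued vectors**:
`(partialFourierSum Φ)(a ⊔ b) = ∫ ψ(u ⬝ᵥ T₀ b) Φ((u + a) ⊔ (u − a)) dμ(u)`. [cite: MoeglinVignerasWaldspurger1987, Chap. 2 II.7] -/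
theorem partialFourierSum_apply_glue (Φ : (ι → F) → ℂ) (a b : κ → F) :
    partialFourierSum ψ μ T₀ e Φ (glue e a b) =
      ∫ u, ((ψ (u ⬝ᵥ (T₀.mulVec b)) : Circle) : ℂ) * Φ (glue e (u + a) (u - a)) ∂μ := by
  simp only [partialFourierSum, resL_glue, resR_glue]

/-- unfolding at a general `v = v|₁ ⊔ v|₂`. [cite: MoeglinVignerasWaldspurger1987, Chap. 2 II.7] -/
theorem partialFourierSum_apply (Φ : (ι → F) → ℂ) (v : ι → F) :
    partialFourierSum ψ μ T₀ e Φ v =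
      ∫ u, ((ψ (u ⬝ᵥ (T₀.mulVec (resR e v))) : Circle) : ℂ) * Φ (glue e (u + resL e v) (u - resL e v)) ∂μ := rfl

end Def

/-! ## §3 The operator as a linear automorphism of `𝒮(F^ι)` -/

section Equiv

variable {F : Type*} [Field F] [ValuativeRel F] [TopologicalSpace F] [IsNonarchimedeanLocalField F]
  {κ ι : Type*} [Fintype κ] [Fintype ι] [DecidableEq κ]
  [MeasurableSpace (κ → F)] [BorelSpace (κ → F)] (μ : Measure (κ → F)) [μ.IsAddHaarMeasure]
  {ψ : AddChar F Circle} (hψ : ψ.IsContinuousNontrivial) {m : ℤ} (hm : ψ.HasConductorExp m)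
  (T₀ : Matrix κ κ F) (hT₀ : IsUnit T₀.det) (e : κ ⊕ κ ≃ ι)

/-- **Fourier transform in the first factor read into the second slot**: on `𝒮(F^κ) ⊗ 𝒮(F^κ)`,
`f₁ ⊗ f₂ ↦ f₂ ⊗ (f̂₁ ∘ T₀)` — the swap followed by `1 ⊗ (piFourierEquivSB ≫ (· ∘ T₀))`, transported to `𝒮(F^ι)` along
`sumEquivSB`. [cite: MoeglinVignerasWaldspurger1987, Chap. 2 II.7] -/
def sumFourierSlotEquivSB : SchwartzBruhat (ι → F) ≃ₗ[ℂ] SchwartzBruhat (ι → F) :=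
  (sumEquivSB F e).symm ≪≫ₗ TensorProduct.comm ℂ _ _ ≪≫ₗ
    TensorProduct.congr (LinearEquiv.refl ℂ _)
      (piFourierEquivSB μ hψ hm ≪≫ₗ compHomeomorphSB (matrixMulVecHomeomorph T₀ hT₀)) ≪≫ₗ sumEquivSB F e

/-- on products: `sumFourierSlotEquivSB (f₁ ⊠ f₂) = f₂ ⊠ (f̂₁ ∘ T₀)`. [cite: MoeglinVignerasWaldspurger1987, Chap. 2 II.7] -/
theorem sumFourierSlotEquivSB_boxSB (f₁ f₂ : SchwartzBruhat (κ → F)) :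
    sumFourierSlotEquivSB μ hψ hm T₀ hT₀ e (boxSB F e f₁ f₂) =
      boxSB F e f₂ (compHomeomorphSB (matrixMulVecHomeomorph T₀ hT₀) (piFourierEquivSB μ hψ hm f₁)) := by
  simp only [sumFourierSlotEquivSB, boxSB, LinearEquiv.trans_apply, LinearEquiv.symm_apply_apply,
    TensorProduct.comm_tmul, TensorProduct.congr_tmul, LinearEquiv.refl_apply]

/-- the value of `sumFourierSlotEquivSB (f₁ ⊠ f₂)` at `a ⊔ b` is `f₂(a) · f̂₁(T₀ b) = ∫ ψ(u ⬝ᵥ T₀ b) f₁(u) f₂(a) dμ(u)`.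
[cite: MoeglinVignerasWaldspurger1987, Chap. 2 II.7] -/
theorem sumFourierSlotEquivSB_boxSB_apply_glue (f₁ f₂ : SchwartzBruhat (κ → F)) (a b : κ → F) :
    ((sumFourierSlotEquivSB μ hψ hm T₀ hT₀ e (boxSB F e f₁ f₂) : SchwartzBruhat (ι → F)) : (ι → F) → ℂ) (glue e a b) =
      ∫ u, ((ψ (u ⬝ᵥ (T₀.mulVec b)) : Circle) : ℂ) *
        ((boxSB F e f₁ f₂ : SchwartzBruhat (ι → F)) : (ι → F) → ℂ) (glue e u a) ∂μ := by
  rw [sumFourierSlotEquivSB_boxSB, boxSB_apply_glue, coe_compHomeomorphSB, coe_piFourierEquivSB,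
    Function.comp_apply, matrixMulVecHomeomorph_apply, piFourierSB_apply, ← integral_const_mul]
  refine integral_congr_ae (Filter.Eventually.of_forall fun u => ?_)
  simp only [boxSB_apply_glue]
  ring

omit [Field F] [ValuativeRel F] [IsNonarchimedeanLocalField F] [Fintype κ] [Fintype ι] [DecidableEq κ]
  [MeasurableSpace (κ → F)] [BorelSpace (κ → F)] [μ.IsAddHaarMeasure] in
/-- a slice `u ↦ Θ(u ⊔ a)` of a Schwartz–Bruhat function on `F^ι` is Schwartz–Bruhat on `F^κ`.
[cite: WeilBNT1967, Ch. VII §2, Def. 1] -/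
theorem slice_mem_schwartzBruhat {Θ : (ι → F) → ℂ} (hΘ : Θ ∈ SchwartzBruhat (ι → F)) (a : κ → F) :
    (fun u : κ → F => Θ (glue e u a)) ∈ SchwartzBruhat (κ → F) := by
  have hc : Continuous fun u : κ → F => glue e u a :=
    (continuous_glue e).comp (continuous_id.prodMk continuous_const)
  refine ⟨hΘ.1.comp_continuous hc, ?_⟩
  -- the support lies in the closed set `K = {u | u ⊔ a ∈ tsupport Θ} ⊆ (tsupport Θ)|₁`, which is compact
  set K : Set (κ → F) := (fun u : κ → F => glue e u a) ⁻¹' tsupport Θ with hK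
  have hKc : IsClosed K := (isClosed_tsupport Θ).preimage hc
  have hKsub : K ⊆ resL e '' tsupport Θ := fun u hu => ⟨glue e u a, hu, resL_glue e u a⟩
  have hKcpt : IsCompact K := (hΘ.2.isCompact.image (continuous_resL (X := F) e)).of_isClosed_subset hKc hKsub
  refine HasCompactSupport.intro' hKcpt hKc fun u hu => ?_
  by_contra h
  exact hu (subset_tsupport _ h)

include hψ in
omit [Fintype ι] [DecidableEq κ] [μ.IsAddHaarMeasure] in
/-- the integrand `u ↦ ψ(u ⬝ᵥ T₀ b) Θ(u ⊔ a)` of the partial Fourier transform is integrable for `Θ ∈ 𝒮(F^ι)`.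
[cite: WeilBNT1967, Ch. VII §2, Prop. 2] -/
theorem integrable_addChar_mul_slice [IsFiniteMeasureOnCompacts μ] {Θ : (ι → F) → ℂ}
    (hΘ : Θ ∈ SchwartzBruhat (ι → F)) (a b : κ → F) :
    Integrable (fun u : κ → F => ((ψ (u ⬝ᵥ (T₀.mulVec b)) : Circle) : ℂ) * Θ (glue e u a)) μ :=
  integrable_modulation_mul (dotProductBilin F F) ψ μ
    (isLocallyConstant_of_isContinuousNontrivial hψ) continuous_dotProductBilin_left (T₀.mulVec b)
    (slice_mem_schwartzBruhat e hΘ a)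

/-- **the structural operator is the integral**: for every `Θ ∈ 𝒮(F^ι)`,
`(sumFourierSlotEquivSB Θ)(a ⊔ b) = ∫ ψ(u ⬝ᵥ T₀ b) Θ(u ⊔ a) dμ(u)` (on pure tensors by `sumFourierSlotEquivSB_boxSB_apply_glue`,
then by additivity of both sides). [cite: MoeglinVignerasWaldspurger1987, Chap. 2 II.7] -/
theorem coe_sumFourierSlotEquivSB_apply_glue (Θ : SchwartzBruhat (ι → F)) (a b : κ → F) :
    ((sumFourierSlotEquivSB μ hψ hm T₀ hT₀ e Θ : SchwartzBruhat (ι → F)) : (ι → F) → ℂ) (glue e a b) =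
      ∫ u, ((ψ (u ⬝ᵥ (T₀.mulVec b)) : Circle) : ℂ) * (Θ : (ι → F) → ℂ) (glue e u a) ∂μ := by
  obtain ⟨z, rfl⟩ := (sumEquivSB F e).surjective Θ
  induction z using TensorProduct.induction_on with
  | zero =>
    simp only [map_zero, ZeroMemClass.coe_zero, Pi.zero_apply, mul_zero, integral_zero]
  | tmul f₁ f₂ =>
    rw [sumEquivSB_tmul]
    exact sumFourierSlotEquivSB_boxSB_apply_glue μ hψ hm T₀ hT₀ e f₁ f₂ a b
  | add x y hx hy =>
    rw [map_add, map_add, Submodule.coe_add, Submodule.coe_add, Pi.add_apply, hx, hy,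
      ← integral_add (integrable_addChar_mul_slice μ hψ T₀ e (sumEquivSB F e x).2 a b)
        (integrable_addChar_mul_slice μ hψ T₀ e (sumEquivSB F e y).2 a b)]
    refine integral_congr_ae (Filter.Eventually.of_forall fun u => ?_)
    simp only [Pi.add_apply, mul_add]

variable [Invertible (2 : F)]

/-- **THE PARTIAL FOURIER TRANSFORM IN THE SUM VARIABLE AS A LINEAR AUTOMORPHISM OF `𝒮(F^ι)`**: precomposition
with the shear `u ⊔ a ↦ (u + a) ⊔ (u − a)`, then `sumFourierSlotEquivSB`. Its underlying function is
`partialFourierSum ψ μ T₀ e Φ` (`coe_partialFourierSumEquivSB`). [cite: MoeglinVignerasWaldspurger1987, Chap. 2 II.7] -/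
def partialFourierSumEquivSB : SchwartzBruhat (ι → F) ≃ₗ[ℂ] SchwartzBruhat (ι → F) :=
  compHomeomorphSB (sumShearHomeomorph (F := F) e) ≪≫ₗ sumFourierSlotEquivSB μ hψ hm T₀ hT₀ e

/-- **the automorphism IS the partial Fourier transform**:
`partialFourierSumEquivSB Φ = partialFourierSum ψ μ T₀ e Φ` as functions on `F^ι`. [cite: MoeglinVignerasWaldspurger1987, Chap. 2 II.7] -/
theorem coe_partialFourierSumEquivSB (Φ : SchwartzBruhat (ι → F)) :
    ((partialFourierSumEquivSB μ hψ hm T₀ hT₀ e Φ : SchwartzBruhat (ι → F)) : (ι → F) → ℂ) =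
      partialFourierSum ψ μ T₀ e Φ := by
  funext v
  conv_lhs => rw [← glue_resL_resR e v]
  rw [partialFourierSum_apply, partialFourierSumEquivSB, LinearEquiv.trans_apply,
    coe_sumFourierSlotEquivSB_apply_glue]
  refine integral_congr_ae (Filter.Eventually.of_forall fun u => ?_)
  simp only [coe_compHomeomorphSB, Function.comp_apply, sumShearHomeomorph_glue]

include hψ hm hT₀ in
/-- **(1) stability**: the partial Fourier transform of a Schwartz–Bruhat function is Schwartz–Bruhat.
[cite: MoeglinVignerasWaldspurger1987, Chap. 2 II.7] -/
theorem partialFourierSum_mem_schwartzBruhat {Φ : (ι → F) → ℂ} (hΦ : Φ ∈ SchwartzBruhat (ι → F)) :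
    partialFourierSum ψ μ T₀ e Φ ∈ SchwartzBruhat (ι → F) := by
  rw [← coe_partialFourierSumEquivSB μ hψ hm T₀ hT₀ e ⟨Φ, hΦ⟩]
  exact (partialFourierSumEquivSB μ hψ hm T₀ hT₀ e ⟨Φ, hΦ⟩).2

include hψ hm hT₀ in
/-- **(2) injectivity on `𝒮(F^ι)`** (partial Fourier inversion). [cite: MoeglinVignerasWaldspurger1987, Chap. 2 II.7] -/
theorem partialFourierSum_injective {Φ Φ' : (ι → F) → ℂ} (hΦ : Φ ∈ SchwartzBruhat (ι → F))
    (hΦ' : Φ' ∈ SchwartzBruhat (ι → F)) (h : partialFourierSum ψ μ T₀ e Φ = partialFourierSum ψ μ T₀ e Φ') :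
    Φ = Φ' := by
  have h1 : partialFourierSumEquivSB μ hψ hm T₀ hT₀ e ⟨Φ, hΦ⟩ = partialFourierSumEquivSB μ hψ hm T₀ hT₀ e ⟨Φ', hΦ'⟩ :=
    Subtype.ext (by rw [coe_partialFourierSumEquivSB, coe_partialFourierSumEquivSB]; exact h)
  exact congrArg Subtype.val ((partialFourierSumEquivSB μ hψ hm T₀ hT₀ e).injective h1)

include hψ hm hT₀ in
/-- **(3) surjectivity onto `𝒮(F^ι)`**. [cite: MoeglinVignerasWaldspurger1987, Chap. 2 II.7] -/
theorem partialFourierSum_surjective {Θ : (ι → F) → ℂ} (hΘ : Θ ∈ SchwartzBruhat (ι → F)) :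
    ∃ Φ : (ι → F) → ℂ, Φ ∈ SchwartzBruhat (ι → F) ∧ partialFourierSum ψ μ T₀ e Φ = Θ := by
  obtain ⟨Φ, hΦ⟩ := (partialFourierSumEquivSB μ hψ hm T₀ hT₀ e).surjective ⟨Θ, hΘ⟩
  exact ⟨Φ, Φ.2, by rw [← coe_partialFourierSumEquivSB μ hψ hm T₀ hT₀ e Φ, hΦ]⟩

include hψ hm hT₀ in
/-- linearity of `Φ ↦ partialFourierSum Φ` on `𝒮(F^ι)` (read off the equivalence). [cite: MoeglinVignerasWaldspurger1987, Chap. 2 II.7] -/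
theorem partialFourierSum_add (Φ Φ' : SchwartzBruhat (ι → F)) :
    partialFourierSum ψ μ T₀ e ((Φ : (ι → F) → ℂ) + Φ') =
      partialFourierSum ψ μ T₀ e Φ + partialFourierSum ψ μ T₀ e Φ' := by
  rw [← Submodule.coe_add, ← coe_partialFourierSumEquivSB μ hψ hm T₀ hT₀ e, map_add, Submodule.coe_add,
    coe_partialFourierSumEquivSB, coe_partialFourierSumEquivSB]

include hψ hm hT₀ in
/-- homogeneity of `Φ ↦ partialFourierSum Φ` on `𝒮(F^ι)`. [cite: MoeglinVignerasWaldspurger1987, Chap. 2 II.7] -/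
theorem partialFourierSum_smul (c : ℂ) (Φ : SchwartzBruhat (ι → F)) :
    partialFourierSum ψ μ T₀ e (c • (Φ : (ι → F) → ℂ)) = c • partialFourierSum ψ μ T₀ e Φ := by
  rw [← Submodule.coe_smul, ← coe_partialFourierSumEquivSB μ hψ hm T₀ hT₀ e, map_smul, Submodule.coe_smul,
    coe_partialFourierSumEquivSB]

end Equiv

end Literature.NumberTheory.Automorphic

end
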